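import Summits.AnomalousDissipation.AnomalousDissipation.Theorems.GenericRunawayStokesScaling.Negative.Deriv

/-!
# Negative knowledge for the crux `MirrorVariety.GenericRunawayStokesScaling` (stmt-AnomalousDissipation-2990), VI:
# the Galerkin truncation conserves HELICITY (finite Fourier proof)

Certified copy of the second half of §10 of the cdisprove work file.  `helicityIdentity_holds`: for every symmetric
frequency set `S` and every `c` in the Galerkin space, `∑_k Re⟪Q_S(c,c)_k, 2πi k × c_k⟫ = 0` (Kraichnan 1973: each
interacting triad conserves energy and helicity).  Proof by finite algebra, no integration by parts: the Leray
multiplier drops out against the transversal curl symbol (`sum_mul_curlVec`); the symmetrised LAMB IDENTITY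
`(c_l·m)c_m + (c_m·l)c_l = (l×c_l)×c_m + (m×c_m)×c_l + (l+m)(c_l·c_m)` (`lamb_pair`, `two_smul_convectionCoeff_lamb`)
kills the gradient part and leaves the real part of the triple form `∑_{l+m+k=0} det(W_l, C_m, W_k)` over `S³`
(`re_inner_two_smul_convectionCoeff_curl`, conjugate symmetry), which vanishes by exchanging `l ↔ k`
(`sum_tripA_eq_zero`, `bdot_crossC_antisymm`).  CONSEQUENCE for the crux: `Range DQ(U) ⊥ U, curl U` at every
truncated-Euler state, so `dim ker DQ(U) ≥ 2` always — the nondegenerate-kernel IFT picture of runaway ends is void;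
and the helicity squeeze of part VII.  Supports stmt-AnomalousDissipation-2990.
-/

set_option linter.dupNamespace false

noncomputable section

open scoped BigOperators InnerProductSpace ComplexConjugate
open Filter Set Function

namespace Summit.AnomalousDissipation.AnomalousDissipation.Theorems.GenericRunawayStokesScaling.Negative

open Literature.Analysis.FunctionSpaces Literature.Analysis.FunctionSpaces.Torus
open Literature.Analysis.FluidPDE Literature.Analysis.FluidPDE.Torus
open Summit.AnomalousDissipation.AnomalousDissipation.Theses.MirrorVariety

/-- `k × v` for an integer frequency and a complex vector. [folklore] -/
def crossK (k : Fin 3 → ℤ) (v : (EuclideanSpace ℂ (Fin 3))) : (EuclideanSpace ℂ (Fin 3)) :=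
  WithLp.toLp 2 ![(k 1 : ℂ) * v 2 - (k 2 : ℂ) * v 1, (k 2 : ℂ) * v 0 - (k 0 : ℂ) * v 2,
    (k 0 : ℂ) * v 1 - (k 1 : ℂ) * v 0]

/-- First coordinate of `k × v`. [folklore] -/
@[simp] theorem crossK_apply_zero (k : Fin 3 → ℤ) (v : (EuclideanSpace ℂ (Fin 3))) :
    crossK k v 0 = (k 1 : ℂ) * v 2 - (k 2 : ℂ) * v 1 := rfl
/-- Second coordinate of `k × v`. [folklore] -/
@[simp] theorem crossK_apply_one (k : Fin 3 → ℤ) (v : (EuclideanSpace ℂ (Fin 3))) :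
    crossK k v 1 = (k 2 : ℂ) * v 0 - (k 0 : ℂ) * v 2 := rfl
/-- Third coordinate of `k × v`. [folklore] -/
@[simp] theorem crossK_apply_two (k : Fin 3 → ℤ) (v : (EuclideanSpace ℂ (Fin 3))) :
    crossK k v 2 = (k 0 : ℂ) * v 1 - (k 1 : ℂ) * v 0 := rfl

/-- The `2πi k ×` symbol of `curl` on a coefficient (`curl (e_k a) = e_k (2πi k × a)`). [folklore] -/
def curlVec (k : Fin 3 → ℤ) (w : (EuclideanSpace ℂ (Fin 3))) : (EuclideanSpace ℂ (Fin 3)) :=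
  (2 * Real.pi * Complex.I) • crossK k w

/-- **Helicity conservation of the truncation, as a named hypothesis** `H_S`:
`∑_k Re⟪Q_S(c,c)_k, 2πi k × c_k⟫ = 0` for every `c` in the Galerkin space. [folklore] -/
def HelicityIdentity (S : Finset (Fin 3 → ℤ)) : Prop :=
  ∀ c ∈ galerkinSubspace S, ∑ k : ↥S, (inner ℂ (projB S c c k) (curlVec (k : Fin 3 → ℤ) (c k))).re = 0

/-! ### Why the helicity identity matters here
(i) Differentiating `⟨Q(U), U⟩ = 0` and `⟨Q(U), curl U⟩ = 0` at a cone point `Q(U) = 0` gives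
`Range L_U ⊥ U, curl U`, so `dim ker L_U ≥ 2` at every non-Beltrami truncated-Euler state and `≥ 6` at
Beltrami (single-shell) ones: the hypothesis `ker L_U = ℝU` of the planner memo's IFT end-construction
(`WarmEndExists`) is NEVER met; the correct Lyapunov–Schmidt reduction at infinity has a 2-dimensional kernel and
the extra obstruction `⟨g, curl U_θ⟩ - μ⟨AU_θ, curl U_θ⟩` (VERDICT block).  (ii) The HELICITY SQUEEZE of §11.
The identity itself (`helicityIdentity_holds`, Kraichnan 1973: each interacting triad conserves energy and
helicity) is PROVED below by finite Fourier algebra — no integration by parts. -/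
/-! ### Proof of the helicity identity (finite Fourier algebra)

`bdot`/`crossC` are the bilinear dot and cross products on `(EuclideanSpace ℂ (Fin 3))`; the proof is: (i) the Leray multiplier drops
out against the transversal `curl` symbol; (ii) the symmetrised LAMB IDENTITY
`(c_l·m)c_m + (c_m·l)c_l = (l×c_l)×c_m + (m×c_m)×c_l + (l+m)(c_l·c_m)` turns `2⟨B(c,c), curl c⟩` into
`2 ∑_{l+m=k} Re⟪(2πi l×c_l)×c_m, 2πi k×c_k⟫` (the gradient part is killed by transversality of `curl`);
(iii) by conjugate symmetry this is the real part of `T = ∑_{l+m+k=0} det(W_l, C_m, W_k)` over `S³`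
(`W = curl` symbol), and `T = -T` by exchanging `l ↔ k` (antisymmetry of `det`). -/

/-- Bilinear (non-conjugated) dot product on `(EuclideanSpace ℂ (Fin 3))`. [folklore] -/
def bdot (a b : (EuclideanSpace ℂ (Fin 3))) : ℂ := ∑ j, a j * b j

/-- Bilinear cross product on `(EuclideanSpace ℂ (Fin 3))`. [folklore] -/
def crossC (a b : (EuclideanSpace ℂ (Fin 3))) : (EuclideanSpace ℂ (Fin 3)) :=
  WithLp.toLp 2 ![a 1 * b 2 - a 2 * b 1, a 2 * b 0 - a 0 * b 2, a 0 * b 1 - a 1 * b 0]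

/-- Coordinates of `crossC`. [folklore] -/
@[simp] theorem crossC_apply_zero (a b : (EuclideanSpace ℂ (Fin 3))) : crossC a b 0 = a 1 * b 2 - a 2 * b 1 := rfl
/-- Coordinates of `crossC`. [folklore] -/
@[simp] theorem crossC_apply_one (a b : (EuclideanSpace ℂ (Fin 3))) : crossC a b 1 = a 2 * b 0 - a 0 * b 2 := rfl
/-- Coordinates of `crossC`. [folklore] -/
@[simp] theorem crossC_apply_two (a b : (EuclideanSpace ℂ (Fin 3))) : crossC a b 2 = a 0 * b 1 - a 1 * b 0 := rfl

/-- `crossK k = crossC (freqVec k)`. [folklore] -/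
theorem crossK_eq_crossC (k : Fin 3 → ℤ) (v : (EuclideanSpace ℂ (Fin 3))) : crossK k v = crossC (freqVec k) v := by
  ext i; fin_cases i <;> simp [freqVec_apply]

/-- `bdot` unfolded on `Fin 3`. [folklore] -/
theorem bdot_eq (a b : (EuclideanSpace ℂ (Fin 3))) : bdot a b = a 0 * b 0 + a 1 * b 1 + a 2 * b 2 := by
  simp [bdot, Fin.sum_univ_three]

/-- **The symmetrised Lamb identity** (pure vector algebra):
`(a·m)b + (b·l)a = (l×a)×b + (m×b)×a + (a·b)(l+m)`. [folklore] -/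
theorem lamb_pair (l m a b : (EuclideanSpace ℂ (Fin 3))) :
    bdot a m • b + bdot b l • a = crossC (crossC l a) b + crossC (crossC m b) a + bdot a b • (l + m) := by
  ext i
  fin_cases i <;> simp [bdot_eq, smul_eq_mul] <;> ring

/-- Antisymmetry of the triple product in its outer slots: `(a×b)·c = -((c×b)·a)`. [folklore] -/
theorem bdot_crossC_antisymm (a b c : (EuclideanSpace ℂ (Fin 3))) : bdot (crossC a b) c = -bdot (crossC c b) a := by
  simp only [bdot_eq, crossC_apply_zero, crossC_apply_one, crossC_apply_two]; ring

/-- `a · (a × b) = 0` coordinatewise form: `∑ᵢ kᵢ (k × w)ᵢ = 0`. [folklore] -/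
theorem sum_mul_crossK (k : Fin 3 → ℤ) (w : (EuclideanSpace ℂ (Fin 3))) : ∑ i, (k i : ℂ) * crossK k w i = 0 := by
  simp only [Fin.sum_univ_three, crossK_apply_zero, crossK_apply_one, crossK_apply_two]; ring

/-- The curl symbol is transversal: `∑ᵢ kᵢ (curlVec k w)ᵢ = 0`. [folklore] -/
theorem sum_mul_curlVec (k : Fin 3 → ℤ) (w : (EuclideanSpace ℂ (Fin 3))) : ∑ i, (k i : ℂ) * curlVec k w i = 0 := by
  have h := sum_mul_crossK k w
  simp only [curlVec, PiLp.smul_apply, smul_eq_mul]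
  calc ∑ i, (k i : ℂ) * (2 * Real.pi * Complex.I * crossK k w i)
      = (2 * Real.pi * Complex.I) * ∑ i, (k i : ℂ) * crossK k w i := by
        rw [Finset.mul_sum]; exact Finset.sum_congr rfl fun i _ => by ring
    _ = 0 := by rw [h, mul_zero]

/-- The Hermitian inner product through `bdot`: `⟪x, y⟫ = bdot (conj x) y`. [folklore] -/
theorem inner_eq_bdot_conjVec (x y : (EuclideanSpace ℂ (Fin 3))) : inner ℂ x y = bdot (EuclideanSpace.conjVec x) y := by
  simp [bdot, PiLp.inner_apply, Fin.sum_univ_three, EuclideanSpace.conjVec_apply]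
  ring

/-- Conjugation is multiplicative on the cross product. [folklore] -/
theorem conjVec_crossC (a b : (EuclideanSpace ℂ (Fin 3))) :
    EuclideanSpace.conjVec (crossC a b) = crossC (EuclideanSpace.conjVec a) (EuclideanSpace.conjVec b) := by
  ext i; fin_cases i <;> simp [EuclideanSpace.conjVec_apply]

/-- `crossC` is homogeneous in the first slot. [folklore] -/
theorem crossC_smul_left (s : ℂ) (a b : (EuclideanSpace ℂ (Fin 3))) : crossC (s • a) b = s • crossC a b := by
  ext i; fin_cases i <;> simp [smul_eq_mul] <;> ring

/-- The curl symbol of a conjugate-symmetric family is conjugate symmetric: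
`conj (curlVec l (C l)) = curlVec (-l) (C (-l))`. [folklore] -/
theorem conjVec_curlVec {C : (Fin 3 → ℤ) → (EuclideanSpace ℂ (Fin 3))} (hC : IsConjSymm C) (l : Fin 3 → ℤ) :
    EuclideanSpace.conjVec (curlVec l (C l)) = curlVec (-l) (C (-l)) := by
  rw [hC l]
  ext i
  fin_cases i <;> simp [curlVec, EuclideanSpace.conjVec_apply, Complex.conj_ofReal, map_ofNat] <;> ring

/-- Pairing with a frequency-parallel vector vanishes against the curl symbol. [folklore] -/
theorem inner_smul_freqVec_curlVec (s : ℂ) (k : Fin 3 → ℤ) (w : (EuclideanSpace ℂ (Fin 3))) :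
    inner ℂ (s • freqVec k) (curlVec k w) = 0 := by
  rw [inner_smul_left, inner_freqVec_left, sum_mul_curlVec, mul_zero]

variable {S : Finset (Fin 3 → ℤ)}

/-- The convection symbol through `bdot`/`freqVec`. [folklore] -/
theorem convectionCoeff_eq_bdot (c c' : (Fin 3 → ℤ) → (EuclideanSpace ℂ (Fin 3))) (k : Fin 3 → ℤ) :
    convectionCoeff S c c' k =
      ∑ l ∈ S, ∑ m ∈ S, if l + m = k then (2 * Real.pi * Complex.I * bdot (c l) (freqVec m)) • c' m else 0 := by
  rw [convectionCoeff_def]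
  simp only [bdot, freqVec_apply]

/-- Symmetrisation of a double sum over the triad condition. [folklore] -/
theorem sum_triad_comm {E : Type*} [AddCommMonoid E] (f : (Fin 3 → ℤ) → (Fin 3 → ℤ) → E) (k : Fin 3 → ℤ) :
    ∑ l ∈ S, ∑ m ∈ S, (if l + m = k then f l m else 0) = ∑ l ∈ S, ∑ m ∈ S, (if l + m = k then f m l else 0) := by
  rw [Finset.sum_comm]
  refine Finset.sum_congr rfl fun m _ => Finset.sum_congr rfl fun l _ => ?_
  rw [add_comm]

/-- **Twice the convection symbol in Lamb form**:
`2 B(c,c)_k = ∑_{l+m=k} [2πi (l×c_l)×c_m + 2πi (m×c_m)×c_l + 2πi (c_l·c_m) k]`. [folklore] -/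
theorem two_smul_convectionCoeff_lamb (C : (Fin 3 → ℤ) → (EuclideanSpace ℂ (Fin 3))) (k : Fin 3 → ℤ) :
    (2 : ℂ) • convectionCoeff S C C k =
      ∑ l ∈ S, ∑ m ∈ S, if l + m = k then
        (crossC (curlVec l (C l)) (C m) + crossC (curlVec m (C m)) (C l) +
          (2 * Real.pi * Complex.I * bdot (C l) (C m)) • freqVec k) else 0 := by
  rw [two_smul, convectionCoeff_eq_bdot]
  conv_lhs => rw [show (∑ l ∈ S, ∑ m ∈ S, if l + m = k then (2 * ↑Real.pi * Complex.I * bdot (C l) (freqVec m)) • C m else 0) +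
      (∑ l ∈ S, ∑ m ∈ S, if l + m = k then (2 * ↑Real.pi * Complex.I * bdot (C l) (freqVec m)) • C m else 0) =
      (∑ l ∈ S, ∑ m ∈ S, if l + m = k then (2 * ↑Real.pi * Complex.I * bdot (C l) (freqVec m)) • C m else 0) +
      (∑ l ∈ S, ∑ m ∈ S, if l + m = k then (2 * ↑Real.pi * Complex.I * bdot (C m) (freqVec l)) • C l else 0) by
      congr 1
      exact sum_triad_comm (fun l m => (2 * ↑Real.pi * Complex.I * bdot (C l) (freqVec m)) • C m) k]
  rw [← Finset.sum_add_distrib]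
  refine Finset.sum_congr rfl fun l _ => ?_
  rw [← Finset.sum_add_distrib]
  refine Finset.sum_congr rfl fun m _ => ?_
  split_ifs with h
  · have hlamb := lamb_pair (freqVec l) (freqVec m) (C l) (C m)
    have hk : freqVec l + freqVec m = freqVec k := by
      rw [← h]; ext i; simp [freqVec_apply]
    rw [hk] at hlamb
    -- multiply the Lamb identity by 2πi
    have := congrArg (fun v : (EuclideanSpace ℂ (Fin 3)) => (2 * Real.pi * Complex.I) • v) hlamb
    simp only [smul_add, smul_smul] at this
    rw [this, curlVec, curlVec, crossK_eq_crossC, crossK_eq_crossC, crossC_smul_left, crossC_smul_left]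
  · simp

/-- The symmetric summand of the triple form: `A(l,m,k) = Re[(W₋ₗ × C₋ₘ) · W_k]`, `W = curl` symbol. [folklore] -/
def tripA (C : (Fin 3 → ℤ) → (EuclideanSpace ℂ (Fin 3))) (l m k : Fin 3 → ℤ) : ℝ :=
  (bdot (crossC (curlVec (-l) (C (-l))) (C (-m))) (curlVec k (C k))).re

/-- Termwise: `Re⟪2 B_k, W_k⟫ = ∑_{l+m=k} (A(l,m,k) + A(m,l,k))`. [folklore] -/
theorem re_inner_two_smul_convectionCoeff_curl {C : (Fin 3 → ℤ) → (EuclideanSpace ℂ (Fin 3))} (hC : IsConjSymm C) (k : Fin 3 → ℤ) :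
    (inner ℂ ((2 : ℂ) • convectionCoeff S C C k) (curlVec k (C k))).re =
      ∑ l ∈ S, ∑ m ∈ S, if l + m = k then tripA C l m k + tripA C m l k else 0 := by
  rw [two_smul_convectionCoeff_lamb, sum_inner, Complex.re_sum]
  refine Finset.sum_congr rfl fun l _ => ?_
  rw [sum_inner, Complex.re_sum]
  refine Finset.sum_congr rfl fun m _ => ?_
  split_ifs with h
  · rw [inner_add_left, inner_add_left, inner_smul_freqVec_curlVec, add_zero, Complex.add_re,
      inner_eq_bdot_conjVec, inner_eq_bdot_conjVec, conjVec_crossC, conjVec_crossC, conjVec_curlVec hC,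
      conjVec_curlVec hC, ← hC l, ← hC m]
    rfl
  · simp

/-- Summing over a symmetric frequency set is invariant under `l ↦ -l`. [folklore] -/
theorem sum_neg_index (hS : ∀ k ∈ S, -k ∈ S) {E : Type*} [AddCommMonoid E] (f : (Fin 3 → ℤ) → E) :
    ∑ l ∈ S, f l = ∑ l ∈ S, f (-l) :=
  Finset.sum_nbij' (fun l => -l) (fun l => -l) (fun l hl => hS l hl) (fun l hl => hS l hl)
    (fun l _ => neg_neg l) (fun l _ => neg_neg l) fun l _ => by rw [neg_neg]

/-- The triad condition after negating two indices. [folklore] -/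
theorem neg_add_neg_eq_iff (l m k : Fin 3 → ℤ) : (-l + -m = k) ↔ (l + m + k = 0) := by
  constructor
  · intro h; rw [← h]; abel
  · intro h
    have hk : k = -(l + m) := by
      have h' : (l + m) + k = 0 := h
      exact (neg_eq_of_add_eq_zero_right h').symm
    rw [hk]; abel

/-- **The triple form vanishes**: `∑_{k,l,m∈S, l+m=k} A(l,m,k) = 0` (reindex by `σ`, then exchange `l ↔ k`:
the determinant is antisymmetric while the condition `l + m + k = 0` is symmetric). [folklore] -/
theorem sum_tripA_eq_zero (hS : ∀ k ∈ S, -k ∈ S) (C : (Fin 3 → ℤ) → (EuclideanSpace ℂ (Fin 3))) :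
    ∑ k ∈ S, ∑ l ∈ S, ∑ m ∈ S, (if l + m = k then tripA C l m k else 0) = 0 := by
  -- the determinant form
  set D : (Fin 3 → ℤ) → (Fin 3 → ℤ) → (Fin 3 → ℤ) → ℝ :=
    fun l m k => (bdot (crossC (curlVec l (C l)) (C m)) (curlVec k (C k))).re with hD
  have hanti : ∀ l m k, D k m l = -D l m k := by
    intro l m k
    simp only [hD, bdot_crossC_antisymm (curlVec k (C k)) (C m) (curlVec l (C l)), Complex.neg_re]
  -- reindex `l ↦ -l`, `m ↦ -m`
  have hre : ∑ k ∈ S, ∑ l ∈ S, ∑ m ∈ S, (if l + m = k then tripA C l m k else 0) =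
      ∑ k ∈ S, ∑ l ∈ S, ∑ m ∈ S, (if l + m + k = 0 then D l m k else 0) := by
    refine Finset.sum_congr rfl fun k _ => ?_
    rw [sum_neg_index hS]
    refine Finset.sum_congr rfl fun l _ => ?_
    rw [sum_neg_index hS]
    refine Finset.sum_congr rfl fun m _ => ?_
    simp only [tripA, neg_neg, hD, neg_add_neg_eq_iff]
  rw [hre]
  -- exchange the two outer sums and use antisymmetry
  set T := ∑ k ∈ S, ∑ l ∈ S, ∑ m ∈ S, (if l + m + k = 0 then D l m k else 0) with hT
  have hswap : T = -T := by
    calc T = ∑ l ∈ S, ∑ k ∈ S, ∑ m ∈ S, (if l + m + k = 0 then D l m k else 0) := Finset.sum_comm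
      _ = ∑ l ∈ S, ∑ k ∈ S, ∑ m ∈ S, (if k + m + l = 0 then -D k m l else 0) := by
          refine Finset.sum_congr rfl fun l _ => Finset.sum_congr rfl fun k _ => Finset.sum_congr rfl fun m _ => ?_
          have hc : (l + m + k = 0) ↔ (k + m + l = 0) := by
            constructor <;> intro h <;> rw [← h] <;> abel
          rw [if_congr hc (by rw [hanti]) rfl]
      _ = -T := by
          rw [hT, ← Finset.sum_neg_distrib]
          refine Finset.sum_congr rfl fun l _ => ?_
          rw [← Finset.sum_neg_distrib]
          refine Finset.sum_congr rfl fun k _ => ?_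
          rw [← Finset.sum_neg_distrib]
          refine Finset.sum_congr rfl fun m _ => ?_
          split_ifs <;> simp
  linarith

/-- **HELICITY CONSERVATION OF THE GALERKIN TRUNCATION** (Kraichnan 1973), finite Fourier proof: for every
symmetric `S` and every `c` in the Galerkin space, `∑_k Re⟪Q_S(c,c)_k, 2πi k × c_k⟫ = 0`. [folklore] -/
theorem helicityIdentity_holds {S : Finset (Fin 3 → ℤ)} (hS : ∀ k ∈ S, -k ∈ S) : HelicityIdentity S := by
  intro c hc
  set C := coeffExt S c with hCdef
  have hC : IsConjSymm C := hc.1.isConjSymm_coeffExt hS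
  -- drop the Leray multiplier and pass to the extended family
  have h1 : ∀ k : ↥S, (inner ℂ (projB S c c k) (curlVec (k : Fin 3 → ℤ) (c k))).re =
      (inner ℂ (convectionCoeff S C C k) (curlVec (k : Fin 3 → ℤ) (C k))).re := by
    intro k
    rw [projB, inner_leraySym_left_of_transversal _ _ (sum_mul_curlVec _ _), hCdef, coeffExt_coe]
  simp only [h1]
  rw [Finset.sum_coe_sort S (fun k => (inner ℂ (convectionCoeff S C C k) (curlVec k (C k))).re)]
  -- `2 ∑ Re⟪B_k, W_k⟫ = ∑ (A + A∘swap) = 2 ∑ A = 0`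
  have h2 : (2 : ℝ) * ∑ k ∈ S, (inner ℂ (convectionCoeff S C C k) (curlVec k (C k))).re =
      ∑ k ∈ S, ∑ l ∈ S, ∑ m ∈ S, (if l + m = k then tripA C l m k + tripA C m l k else 0) := by
    rw [Finset.mul_sum]
    refine Finset.sum_congr rfl fun k _ => ?_
    rw [← re_inner_two_smul_convectionCoeff_curl hC k, inner_smul_left, map_ofNat]
    simp
  have h3 : ∀ k ∈ S, (∑ l ∈ S, ∑ m ∈ S, if l + m = k then tripA C l m k + tripA C m l k else 0) =
      2 * ∑ l ∈ S, ∑ m ∈ S, (if l + m = k then tripA C l m k else 0) := by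
    intro k _
    have hsym : (∑ l ∈ S, ∑ m ∈ S, if l + m = k then tripA C m l k else 0) =
        ∑ l ∈ S, ∑ m ∈ S, if l + m = k then tripA C l m k else 0 :=
      (sum_triad_comm (fun l m => tripA C l m k) k).symm
    have hsplit : (∑ l ∈ S, ∑ m ∈ S, if l + m = k then tripA C l m k + tripA C m l k else 0) =
        (∑ l ∈ S, ∑ m ∈ S, if l + m = k then tripA C l m k else 0) +
          ∑ l ∈ S, ∑ m ∈ S, if l + m = k then tripA C m l k else 0 := by
      rw [← Finset.sum_add_distrib]
      refine Finset.sum_congr rfl fun l _ => ?_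
      rw [← Finset.sum_add_distrib]
      refine Finset.sum_congr rfl fun m _ => ?_
      split_ifs <;> simp
    rw [hsplit, hsym]; ring
  have h5 : ∑ k ∈ S, ∑ l ∈ S, ∑ m ∈ S, (if l + m = k then tripA C l m k + tripA C m l k else 0) =
      2 * ∑ k ∈ S, ∑ l ∈ S, ∑ m ∈ S, (if l + m = k then tripA C l m k else 0) := by
    rw [Finset.mul_sum]
    exact Finset.sum_congr rfl h3
  have h4 := sum_tripA_eq_zero hS C
  linarith


end Summit.AnomalousDissipation.AnomalousDissipation.Theorems.GenericRunawayStokesScaling.Negative
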